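import Literature.Combinatorics.LorentzianPolynomials.Rayleigh
import HarnessLib

/-!
# The Rayleigh constant `2(1 - 1/d)` is optimal for `n ≥ 3`: the case `d = 2`
# (Brändén–Huh 2020, §2.4 Prop. 2.24, second statement, in degree two)

Layer `Literature/Combinatorics/LorentzianPolynomials`, namespace `Literature.Combinatorics.LorentzianPolynomials`;
lane `lit-hodgefound` (Track 2 foundations library), seat p16, generation 27 (row g27-#18). Companion to `Rayleigh.lean`
(Prop. 2.19 in degree `2`: every `q ∈ L^2_n` is `1`-Rayleigh): in three or more variables no smaller constant works.

## Source (verbatim) — P. Brändén, J. Huh, *Lorentzian polynomials* [BrandenHuh2019] (held `paper:arxiv-1902.03719`)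

§2.4, Prop. 2.24: "When `n ≤ 2`, all polynomials in `L^d_n` are `1`-Rayleigh. When `n ≥ 3`, we have (all polynomials in
`L^d_n` are `c`-Rayleigh) ⟹ `c ≥ 2(1 - 1/d)`. In other words, for any `n ≥ 3` and any `c < 2(1 - 1/d)`, there is
`f ∈ L^d_n` that is not `c`-Rayleigh." Proof of the second statement: "consider the polynomial
`f = 2(1 - 1/d) w_1^d + w_1^{d-1} w_2 + w_1^{d-1} w_3 + w_1^{d-2} w_2 w_3`. It is straightforward to check that `f` is in
`L^d_n`. If `f` is `c`-Rayleigh, then, for any `w ∈ ℝ^n_{≥0}`,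
`w_1^{2d-4} (2(1 - 1/d) w_1^2 + w_1 w_2 + w_1 w_3 + w_2 w_3) ≤ c w_1^{2d-4} (w_1 + w_2)(w_1 + w_3)`. The desired lower bound
for `c` is obtained by setting `w_1 = 1, w_2 = 0, w_3 = 0`."

## What is here (the case `d = 2`, where `2(1 - 1/d) = 1` and `f = w_a² + w_a w_b + w_a w_c + w_b w_c`)

* `bhQuadratic a b c = X_a² + X_a X_b + X_a X_c + X_b X_c` for three distinct variables `a, b, c ∈ σ` (`n ≥ 3`), its
  evaluations and first/second partial derivatives;
* **`bhQuadratic_mem_lorentzian`**: it is Lorentzian ("straightforward to check": its Hessian is non-positive on the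
  `𝓗`-orthogonal complement of `e_a`, via `toBilin'_hessian_eq_eval` = polarisation of `2 q(x) = xᵀ𝓗x`);
* **`not_isCRayleigh_bhQuadratic`**: it is not `c`-Rayleigh for any `c < 1` (Def. 2.18 at `α = 0`, `i = b`, `j = c`,
  `w = e_a` reads `1 ≤ c`);
* **`exists_mem_lorentzian_two_not_isCRayleigh`**: Prop. 2.24 (second statement) for `d = 2` — on any `σ` with three
  distinct elements and any `c < 1 = 2(1 - 1/2)` some `q ∈ L^2_σ` is not `c`-Rayleigh; with Prop. 2.19 (`d = 2`,
  `isCRayleigh_one_of_mem_lorentzian_two`) the constant `1` is optimal (`isCRayleigh_forall_lorentzian_two_iff`).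

One definition with body (`bhQuadratic`), theorems otherwise; no `sorry`, no named fact.
-- TODO(general form): Prop. 2.24 for all `d` (the same polynomial `f`, `L^d_n`-membership through all `∂^α f`), and the
first statement (`n ≤ 2`).

## References

* [BrandenHuh2019] P. Brändén, J. Huh, *Lorentzian polynomials*, Ann. of Math. (2) 192 (2020) 821–891, arXiv:1902.03719 —
  §2.4 Prop. 2.24.
-/

noncomputable section

open MvPolynomial Finsupp Finset Matrix
open Literature.LinearAlgebra.QuadraticForm

namespace Literature.Combinatorics.LorentzianPolynomials

variable {σ : Type*} [Fintype σ]

/-! ## §1 The polynomial `w_a² + w_a w_b + w_a w_c + w_b w_c` -/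

section Example

/-- **Brändén–Huh's extremal polynomial in degree `2`**: `f = 2(1 - 1/d) w_1^d + w_1^{d-1} w_2 + w_1^{d-1} w_3 + w_1^{d-2} w_2 w_3`
at `d = 2`, i.e. `w_a² + w_a w_b + w_a w_c + w_b w_c`, on three variables `a, b, c ∈ σ`.
[cite: BrandenHuh2019, §2.4 proof of Prop. 2.24] -/
def bhQuadratic (a b c : σ) : MvPolynomial σ ℝ := X a * X a + X a * X b + X a * X c + X b * X c

omit [Fintype σ] in
/-- Unfolding `bhQuadratic`. [cite: BrandenHuh2019, §2.4 proof of Prop. 2.24] -/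
theorem bhQuadratic_def (a b c : σ) : bhQuadratic a b c = X a * X a + X a * X b + X a * X c + X b * X c := rfl

omit [Fintype σ] in
/-- `f(x) = x_a² + x_a x_b + x_a x_c + x_b x_c`. [cite: BrandenHuh2019, §2.4 proof of Prop. 2.24] -/
theorem eval_bhQuadratic (a b c : σ) (x : σ → ℝ) :
    eval x (bhQuadratic a b c) = x a * x a + x a * x b + x a * x c + x b * x c := by
  simp only [bhQuadratic, map_add, map_mul, eval_X]

omit [Fintype σ] in
/-- `f` is homogeneous of degree `2`. [cite: BrandenHuh2019, §2.4 proof of Prop. 2.24 ("`f` is in `L^d_n`")] -/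
theorem isHomogeneous_bhQuadratic (a b c : σ) : (bhQuadratic a b c).IsHomogeneous 2 := by
  have hX : ∀ i j : σ, (X i * X j : MvPolynomial σ ℝ).IsHomogeneous 2 := fun i j ↦
    (isHomogeneous_X ℝ i).mul (isHomogeneous_X ℝ j)
  exact (((hX a a).add (hX a b)).add (hX a c)).add (hX b c)

omit [Fintype σ] in
/-- `f` has nonnegative coefficients (all equal to `0` or `1`… or `2` never: the four monomials are distinct when `a, b, c`
are; nonnegativity needs no distinctness). [cite: BrandenHuh2019, §2.4 proof of Prop. 2.24] -/
theorem coeff_bhQuadratic_nonneg (a b c : σ) (β : σ →₀ ℕ) : 0 ≤ coeff β (bhQuadratic a b c) := by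
  classical
  have hX : ∀ i j : σ, 0 ≤ coeff β (X i * X j : MvPolynomial σ ℝ) := fun i j ↦ by
    rw [X, X, monomial_mul, coeff_monomial]
    split_ifs <;> norm_num
  rw [bhQuadratic, coeff_add, coeff_add, coeff_add]
  exact add_nonneg (add_nonneg (add_nonneg (hX a a) (hX a b)) (hX a c)) (hX b c)

omit [Fintype σ] in
/-- `∂_c f = w_a + w_b` (for `c ≠ a, b`). [cite: BrandenHuh2019, §2.4 proof of Prop. 2.24 ("`(w_1 + w_2)(w_1 + w_3)`")] -/
theorem pderiv_bhQuadratic_right {a b c : σ} (hac : a ≠ c) (hbc : b ≠ c) :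
    pderiv c (bhQuadratic a b c) = X a + X b := by
  classical
  simp only [bhQuadratic, map_add, pderiv_mul, pderiv_X_self, pderiv_X_of_ne hac, pderiv_X_of_ne hbc]
  ring

omit [Fintype σ] in
/-- `∂_b f = w_a + w_c` (for `b ≠ a, c`). [cite: BrandenHuh2019, §2.4 proof of Prop. 2.24 ("`(w_1 + w_2)(w_1 + w_3)`")] -/
theorem pderiv_bhQuadratic_mid {a b c : σ} (hab : a ≠ b) (hbc : b ≠ c) :
    pderiv b (bhQuadratic a b c) = X a + X c := by
  classical
  simp only [bhQuadratic, map_add, pderiv_mul, pderiv_X_self, pderiv_X_of_ne hab, pderiv_X_of_ne hbc.symm]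
  ring

omit [Fintype σ] in
/-- `∂_b ∂_c f = 1` (for distinct `a, b, c`). [cite: BrandenHuh2019, §2.4 proof of Prop. 2.24] -/
theorem pderiv_pderiv_bhQuadratic {a b c : σ} (hab : a ≠ b) (hac : a ≠ c) (hbc : b ≠ c) :
    pderiv b (pderiv c (bhQuadratic a b c)) = 1 := by
  classical
  rw [pderiv_bhQuadratic_right hac hbc, map_add, pderiv_X_of_ne hab, pderiv_X_self, zero_add]

end Example

/-! ## §2 It is Lorentzian -/

section Lorentzian

variable [DecidableEq σ]

/-- **Polarisation**: `uᵀ𝓗_q v = q(u + v) - q(u) - q(v)` for a quadratic form `q` (from `2 q(x) = xᵀ𝓗_q x`).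
[cite: BrandenHuh2019, §2.1 Lemma 2.5 (proof, "`u^T 𝓗_f v`")] -/
theorem toBilin'_hessian_eq_eval {q : MvPolynomial σ ℝ} (hq : q.IsHomogeneous 2) (u v : σ → ℝ) :
    Matrix.toBilin' (hessian q) u v = eval (u + v) q - eval u q - eval v q := by
  have h := two_mul_eval_eq_toBilin'_hessian hq (u + v)
  have hu := two_mul_eval_eq_toBilin'_hessian hq u
  have hv := two_mul_eval_eq_toBilin'_hessian hq v
  have hc := toBilin'_hessian_comm q u v
  simp only [map_add, LinearMap.add_apply] at h
  linarith

/-- **`f = w_a² + w_a w_b + w_a w_c + w_b w_c` is Lorentzian** for `a ≠ b, c` ("It is straightforward to check that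
`f` is in `L^d_n`"): on the `𝓗_f`-orthogonal complement `{z : 2 z_a + z_b + z_c = 0}` of `e_a` the form
`zᵀ𝓗_f z = 2 f(z) = -2 z_a² + 2 z_b z_c = -(z_b - z_c)²/2 ≤ 0`, so `𝓗_f` has at most one positive eigenvalue.
[cite: BrandenHuh2019, §2.4 proof of Prop. 2.24] -/
theorem bhQuadratic_mem_lorentzian {a b c : σ} (hab : a ≠ b) (hac : a ≠ c) :
    bhQuadratic a b c ∈ lorentzian σ 2 := by
  have hq := isHomogeneous_bhQuadratic a b c
  refine mem_lorentzian_two_iff_sigPos.2 ⟨hq, coeff_bhQuadratic_nonneg a b c, ?_⟩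
  refine sigPos_le_one_of_orthogonal_nonpos (Matrix.toBilin' (hessian (bhQuadratic a b c))) (w := Pi.single a 1)
    fun z hz ↦ ?_
  rw [toBilin'_hessian_eq_eval hq, eval_bhQuadratic, eval_bhQuadratic, eval_bhQuadratic] at hz
  simp only [Pi.add_apply, Pi.single_eq_same, Pi.single_eq_of_ne' hab, Pi.single_eq_of_ne' hac] at hz
  rw [← two_mul_eval_eq_toBilin'_hessian hq, eval_bhQuadratic]
  nlinarith [hz, sq_nonneg (z b - z c)]

end Lorentzian

/-! ## §3 It is not `c`-Rayleigh for `c < 1`, and Prop. 2.24 in degree two -/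

section Optimal

variable [DecidableEq σ]

/-- **`f` is not `c`-Rayleigh for `c < 1`**: Def. 2.18 at `α = 0`, `i = b`, `j = c` and `w = e_a` reads
`f(e_a) ∂_b∂_c f(e_a) = 1 ≤ c = c ∂_b f(e_a) ∂_c f(e_a)` ("The desired lower bound for `c` is obtained by setting
`w_1 = 1, w_2 = 0, w_3 = 0`"). [cite: BrandenHuh2019, §2.4 proof of Prop. 2.24] -/
theorem not_isCRayleigh_bhQuadratic {a b c : σ} (hab : a ≠ b) (hac : a ≠ c) (hbc : b ≠ c) {r : ℝ} (hr : r < 1) :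
    ¬ IsCRayleigh r (bhQuadratic a b c) := by
  intro h
  have hle := h.eval_mul_eval_pderiv_pderiv_le b c (w := Pi.single a 1) fun k ↦ by
    by_cases hk : k = a
    · subst hk; rw [Pi.single_eq_same]; exact zero_le_one
    · rw [Pi.single_eq_of_ne hk]
  rw [pderiv_pderiv_bhQuadratic hab hac hbc, pderiv_bhQuadratic_mid hab hbc, pderiv_bhQuadratic_right hac hbc,
    eval_bhQuadratic, map_one, map_add, map_add] at hle
  simp only [eval_X, Pi.single_eq_same, Pi.single_eq_of_ne' hab, Pi.single_eq_of_ne' hac, mul_zero, mul_one, add_zero]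
    at hle
  linarith

/-- **Brändén–Huh Prop. 2.24, second statement, in degree `2`**: on any variable set with at least three elements and for
any `c < 1 = 2(1 - 1/2)` there is a Lorentzian quadratic form that is not `c`-Rayleigh.
[cite: BrandenHuh2019, §2.4 Prop. 2.24 (second statement, `d = 2`)] -/
theorem exists_mem_lorentzian_two_not_isCRayleigh (h3 : ∃ a b c : σ, a ≠ b ∧ a ≠ c ∧ b ≠ c) {r : ℝ} (hr : r < 1) :
    ∃ q ∈ lorentzian σ 2, ¬ IsCRayleigh r q := by
  obtain ⟨a, b, c, hab, hac, hbc⟩ := h3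
  exact ⟨bhQuadratic a b c, bhQuadratic_mem_lorentzian hab hac, not_isCRayleigh_bhQuadratic hab hac hbc hr⟩

/-- The same in Brändén–Huh's phrasing "(all polynomials in `L^d_n` are `c`-Rayleigh) ⟹ `c ≥ 2(1 - 1/d)`", `d = 2`.
[cite: BrandenHuh2019, §2.4 Prop. 2.24 (second statement, `d = 2`)] -/
theorem one_le_of_forall_lorentzian_two_isCRayleigh (h3 : ∃ a b c : σ, a ≠ b ∧ a ≠ c ∧ b ≠ c) {r : ℝ}
    (h : ∀ q ∈ lorentzian σ 2, IsCRayleigh r q) : 2 * (1 - 1 / (2 : ℝ)) ≤ r := by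
  norm_num
  by_contra hr
  obtain ⟨q, hq, hnot⟩ := exists_mem_lorentzian_two_not_isCRayleigh h3 (lt_of_not_ge hr)
  exact hnot (h q hq)

/-- **The optimal Rayleigh constant in degree `2` is `1`** (`n ≥ 3`): all Lorentzian quadratic forms on `σ` are
`c`-Rayleigh iff `1 ≤ c` (Prop. 2.19 for `⟸`, Prop. 2.24 for `⟹`).
[cite: BrandenHuh2019, §2.4 Prop. 2.19 and Prop. 2.24 (`d = 2`)] -/
theorem forall_lorentzian_two_isCRayleigh_iff (h3 : ∃ a b c : σ, a ≠ b ∧ a ≠ c ∧ b ≠ c) (r : ℝ) :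
    (∀ q ∈ lorentzian σ 2, IsCRayleigh r q) ↔ 1 ≤ r := by
  constructor
  · intro h
    have h1 := one_le_of_forall_lorentzian_two_isCRayleigh h3 h
    norm_num at h1
    exact h1
  · intro hr q hq
    exact (isCRayleigh_one_of_mem_lorentzian_two hq).mono hr

end Optimal

end Literature.Combinatorics.LorentzianPolynomials

end
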